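import Literature.NumberTheory.LFunctions.ZetaLogDerivLeftLineAsymptotics
import Literature.NumberTheory.LFunctions.ZetaLogDerivRealBound
import Literature.NumberTheory.LFunctions.RiemannSiegelFacts
import HarnessLib

/-!
# Ford's Lemma 3.2: `|ζ'/ζ(−1/2 + iu)| ≤ 4.62 + ½ log(1 + u²/9)`

Topic `Literature/NumberTheory/LFunctions`, family RH (explicit zero-free regions). Everything in
this file is PROVED; no named fact is introduced.

K. Ford, *Zero-free regions for the Riemann zeta function* (2002), **Lemma 3.2**: for real `u`,
`|ζ'(−½ + iu)/ζ(−½ + iu)| ≤ 4.62 + ½ log(1 + u²/9)`. It bounds the integrand on the line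
`Re w = −1/2` to which the contour is moved in Ford's Lemma 4.5 (the smoothed explicit formula for
`K(s) = Σ Λ(n) n^{−s} f(log n)`), and thereby the constant `1.72` (`= 4.62·⅓ + …`) of that lemma.

* `FordL32.norm_logDeriv_zeta_left_le` — the statement, for every real `u`.

Ford derives it from the Hadamard-product form of the functional equation with
`−ζ'/ζ(3/2) = 1.505…`. We argue through the tree's form of the functional equation
(`PsiOneExplicit.logDeriv_riemannZeta_eq_logDeriv_riemannXi`, `logDeriv_riemannXi_one_sub`,
`PsiOneExplicit.logDeriv_Gammaℝ_eq_shift`):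

  `ζ'/ζ(s) = −ζ'/ζ(s') + log π − Re ψ(z) + 1/s`,  `s = −½ + iu`, `s' = 3/2 − iu`, `z = ¾ + iu/2`

(`FordL32.logDeriv_zeta_left_eq`; `ψ` = digamma), and bound `|ζ'/ζ(s')| < 2`
(`norm_deriv_riemannZeta_div_lt`) and `|Φ + iΨ|`, `Φ = log π − Re ψ(z) − 2/(1+4u²)`,
`Ψ = −4u/(1+4u²)`, in three ranges of `|u|`, using about `Re ψ` only:
the series `Re ψ(x+iy) + γ = Σ [1/(k+1) − (x+k)/((x+k)²+y²)]` (`FordL32.hasSum_re_digamma`, real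
part of Andrews–Askey–Roy (1.2.13) = the tree's `hasSum_one_div_sub_one_div_digamma`), hence
**monotonicity of `Re ψ(x + iy)` in `|y|`** (`FordL32.re_digamma_mono`) and `Re ψ(¾) > −4/3`
(`FordL32.re_digamma_three_quarters_ge`, comparison with a telescoping series and `γ < 2/3`), and the
tree's Stirling-type bound `|Re ψ(w) − log‖w‖| ≤ 1/(2‖w‖²) + π/(4|Im w|)`
(`abs_re_digamma_sub_log_norm_le`) at `¾ + i`, `¾ + 4i` and for `|Im w| ≥ 4`. The resulting bounds
are `4.57` (`|u| ≤ 2`), `4.53` (`2 < |u| ≤ 8`) and `1.9 + ½ log(1 + u²/9)` (`|u| > 8`), i.e. the lemma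
holds with room to spare even though `−ζ'/ζ(3/2)` is only bounded by `2` here (near `u = 0` the
true value is `ζ'/ζ(−½) = 1.73…`, and keeping the real part of `1/s` against `log π − Re ψ` captures
most of the cancellation that Ford's termwise treatment gives away).

Numerical inputs: `1.09 < log π < 1.145` (`FordL32.lt_log_pi`, `FordL32.log_pi_lt`, from
Mathlib's decimal bounds for `π`, `e` and `1 + x + x²/2 ≤ eˣ`), Mathlib's `log 2` to nine places,
`log x ≤ x − 1`.

## References

* K. Ford, *Zero-free regions for the Riemann zeta function*, Number Theory for the Millennium II
  (Urbana 2000), A K Peters 2002, 25–56 (arXiv:1910.08205), Lemma 3.2. [Ford2002Millennium]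
* G. E. Andrews, R. Askey, R. Roy, *Special Functions*, CUP 1999, Thm. 1.2.5 (1.2.13).
  [AndrewsAskeyRoy1999]
-/

noncomputable section

open Complex Filter Topology Set
open scoped Real ComplexConjugate

namespace Literature.NumberTheory.LFunctions

namespace FordL32

open Literature.Analysis.SpecialFunctions.Complex

/-! ### The real part of `ψ` on vertical lines: series, monotonicity, values -/

/-- The real part of `1/(x + iy + k)`. [folklore] -/
theorem re_one_div (x y : ℝ) (k : ℕ) :
    (1 / ((x : ℂ) + (y : ℂ) * I + (k : ℂ))).re = (x + k) / ((x + k) ^ 2 + y ^ 2) := by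
  have h := re_one_div_add_ofReal ((x : ℂ) + (y : ℂ) * I) (k : ℝ)
  simp only [add_re, ofReal_re, mul_re, I_re, mul_zero, ofReal_im, I_im, mul_one, sub_self,
    add_zero, add_im, mul_im, zero_add] at h
  rw [← Complex.ofReal_natCast]
  exact h

/-- **Series for `Re ψ` on a vertical line** (real part of Andrews–Askey–Roy (1.2.13)):
`Re ψ(x + iy) + γ = Σ_{k ≥ 0} [1/(k+1) − (x+k)/((x+k)² + y²)]` for `x > 0`.
[cite: AndrewsAskeyRoy1999, Thm 1.2.5 (1.2.13)] -/
theorem hasSum_re_digamma {x : ℝ} (hx : 0 < x) (y : ℝ) :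
    HasSum (fun k : ℕ ↦ 1 / ((k : ℝ) + 1) - (x + k) / ((x + k) ^ 2 + y ^ 2))
      ((digamma ((x : ℂ) + (y : ℂ) * I)).re + Real.eulerMascheroniConstant) := by
  have hw : 0 < ((x : ℂ) + (y : ℂ) * I).re := by simpa using hx
  have h := Complex.hasSum_re (hasSum_one_div_sub_one_div_digamma hw)
  simp only [add_re, ofReal_re] at h
  refine h.congr_fun fun k ↦ ?_
  rw [sub_re, re_one_div x y k]
  congr 1
  rw [show (k : ℂ) + 1 = ((k + 1 : ℝ) : ℂ) by push_cast; ring, ← ofReal_one, ← ofReal_div, ofReal_re]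

/-- **`Re ψ(x + iy)` is non-decreasing in `|y|`** (`x > 0`): each term `(x+k)/((x+k)² + y²)` of
the series decreases. [folklore] -/
theorem re_digamma_mono {x y₁ y₂ : ℝ} (hx : 0 < x) (h : |y₁| ≤ |y₂|) :
    (digamma ((x : ℂ) + (y₁ : ℂ) * I)).re ≤ (digamma ((x : ℂ) + (y₂ : ℂ) * I)).re := by
  have h1 := hasSum_re_digamma hx y₁
  have h2 := hasSum_re_digamma hx y₂
  have hsq : y₁ ^ 2 ≤ y₂ ^ 2 := by nlinarith [abs_nonneg y₁, sq_abs y₁, sq_abs y₂]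
  have := hasSum_le (fun k ↦ ?_) h1 h2
  · linarith
  have hxk : 0 < x + k := by positivity
  have hd : 0 < (x + k) ^ 2 + y₁ ^ 2 := by positivity
  apply sub_le_sub_left
  exact div_le_div_of_nonneg_left hxk.le hd (by linarith)

/-- `Re ψ(3/4) ≥ −2/3 − γ > −4/3` (comparison of the series at `3/4` with the telescoping series
`−1/3 − ¼ Σ_{k≥0} [1/(k+¾) − 1/(k+7/4)] = −2/3`). [folklore] -/
theorem re_digamma_three_quarters_ge :
    -(4 / 3 : ℝ) ≤ (digamma (((3 / 4 : ℝ) : ℂ) + ((0 : ℝ) : ℂ) * I)).re := by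
  have hf := hasSum_re_digamma (by norm_num : (0 : ℝ) < 3 / 4) 0
  -- the comparison series `g 0 = -1/3`, `g (j+1) = -(1/4) (a j - a (j+1))`, `a j = 1/(j + 3/4)`
  set a : ℕ → ℝ := fun j ↦ 1 / ((j : ℝ) + 3 / 4) with ha
  have ha0 : ∀ j, 0 < a j := fun j ↦ by simp only [ha]; positivity
  have hamono : ∀ j, a (j + 1) ≤ a j := fun j ↦ by
    simp only [ha]; push_cast
    exact one_div_le_one_div_of_le (by positivity) (by linarith)
  have hatend : Tendsto a atTop (𝓝 0) := by
    simp only [ha]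
    exact tendsto_const_nhds.div_atTop (tendsto_atTop_add_const_right _ _ tendsto_natCast_atTop_atTop)
  -- Σ (a j - a (j+1)) = a 0 = 4/3
  have htel : HasSum (fun j ↦ a j - a (j + 1)) (4 / 3) := by
    have h43 : a 0 = 4 / 3 := by norm_num [ha]
    rw [← h43]
    refine (hasSum_iff_tendsto_nat_of_nonneg (fun j ↦ sub_nonneg.2 (hamono j)) _).2 ?_
    have : (fun n : ℕ ↦ ∑ j ∈ Finset.range n, (a j - a (j + 1))) = fun n ↦ a 0 - a n := by
      funext n; rw [Finset.sum_range_sub']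
    rw [this]
    simpa using (tendsto_const_nhds (x := a 0)).sub hatend
  set g : ℕ → ℝ := fun k ↦ if k = 0 then -(1 / 3) else -(1 / 4) * (a (k - 1) - a k) with hg
  have hg_sum : HasSum g (-(1 / 3) + -(1 / 4) * (4 / 3)) := by
    have h1 : HasSum (fun j ↦ g (j + 1)) (-(1 / 4) * (4 / 3)) := by
      have := htel.mul_left (-(1 / 4))
      refine this.congr_fun fun j ↦ ?_
      simp [hg]
    have h0 := h1.zero_add  -- HasSum over ℕ from the shifted one plus g 0
    simpa [hg] using h0
  have hcomp : ∀ k, g k ≤ 1 / ((k : ℝ) + 1) - (3 / 4 + k) / ((3 / 4 + k) ^ 2 + (0 : ℝ) ^ 2) := by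
    intro k
    rcases Nat.eq_zero_or_pos k with hk | hk
    · subst hk; simp [hg]; norm_num
    · obtain ⟨j, rfl⟩ := Nat.exists_eq_add_of_le' hk
      simp only [hg, Nat.add_sub_cancel, ha, if_neg (Nat.succ_ne_zero j)]
      push_cast
      have hj : (0 : ℝ) ≤ j := Nat.cast_nonneg j
      rw [show (3 / 4 + ((j : ℝ) + 1)) / ((3 / 4 + ((j : ℝ) + 1)) ^ 2 + (0 : ℝ) ^ 2) =
        1 / ((j : ℝ) + 7 / 4) by field_simp; ring]
      rw [show -(1 / 4) * (1 / ((j : ℝ) + 3 / 4) - 1 / ((j : ℝ) + 1 + 3 / 4)) =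
        -(1 / 4) / (((j : ℝ) + 3 / 4) * ((j : ℝ) + 7 / 4)) by field_simp; ring]
      rw [show 1 / ((j : ℝ) + 1 + 1) - 1 / ((j : ℝ) + 7 / 4) =
        -(1 / 4) / (((j : ℝ) + 2) * ((j : ℝ) + 7 / 4)) by field_simp; ring]
      rw [neg_div, neg_div, neg_le_neg_iff]
      exact div_le_div_of_nonneg_left (by norm_num) (by positivity) (by nlinarith)
  have hle := hasSum_le hcomp hg_sum hf
  have hγ := Real.eulerMascheroniConstant_lt_two_thirds
  linarith

/-! ### Numerical constants -/

/-- `log π < 1.145`. [folklore] -/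
theorem log_pi_lt : Real.log π < 1.145 := by
  rw [Real.log_lt_iff_lt_exp Real.pi_pos]
  have hπ := Real.pi_lt_d6
  have h1 := Real.exp_one_gt_d9
  have hx : (0 : ℝ) ≤ 0.145 / 3 := by norm_num
  have h2 := Real.quadratic_le_exp_of_nonneg hx
  have h3 : Real.exp 1.145 = Real.exp 1 * Real.exp (0.145 / 3) ^ 3 := by
    rw [← Real.exp_nat_mul, ← Real.exp_add]; norm_num
  rw [h3]
  have h4 : (1.0495 : ℝ) ≤ Real.exp (0.145 / 3) := le_trans (by norm_num) h2
  have h5 : (1.0495 : ℝ) ^ 3 ≤ Real.exp (0.145 / 3) ^ 3 := pow_le_pow_left₀ (by norm_num) h4 3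
  nlinarith

/-- `1.09 < log π`. [folklore] -/
theorem lt_log_pi : 1.09 < Real.log π := by
  rw [Real.lt_log_iff_exp_lt Real.pi_pos]
  have hπ := Real.pi_gt_three
  have h1 := Real.exp_one_lt_d9
  have h2 : Real.exp 0.09 * 0.91 ≤ 1 := by
    have h := Real.add_one_le_exp (-0.09)
    have e : Real.exp 0.09 * Real.exp (-0.09) = 1 := by rw [← Real.exp_add]; norm_num
    nlinarith [Real.exp_pos 0.09]
  have h3 : Real.exp 1.09 = Real.exp 1 * Real.exp 0.09 := by rw [← Real.exp_add]; norm_num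
  rw [h3]
  nlinarith [Real.exp_pos 0.09, Real.exp_pos 1]

/-- `log 2 < 0.6931471808` and `0.6931471803 < log 2` (Mathlib). [folklore] -/
theorem log_two_bounds : 0.6931471803 < Real.log 2 ∧ Real.log 2 < 0.6931471808 :=
  ⟨Real.log_two_gt_d9, Real.log_two_lt_d9⟩

/-- `Re ψ(3/4 + i) ≤ 1.36` (`log‖w‖ = log(5/4) ≤ 1/4`, `1/(2‖w‖²) = 8/25`, `π/4 < 0.7854`).
[folklore] -/
theorem re_digamma_three_quarters_add_I_le :
    (digamma (((3 / 4 : ℝ) : ℂ) + ((1 : ℝ) : ℂ) * I)).re ≤ 1.36 := by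
  set w : ℂ := ((3 / 4 : ℝ) : ℂ) + ((1 : ℝ) : ℂ) * I with hw
  have hre : w.re = 3 / 4 := by simp [hw]
  have him : w.im = 1 := by simp [hw]
  have hsq : ‖w‖ ^ 2 = (5 / 4) ^ 2 := by
    rw [Complex.sq_norm, Complex.normSq_apply, hre, him]; norm_num
  have hnorm : ‖w‖ = 5 / 4 := by
    nlinarith [norm_nonneg w]
  have h := re_digamma_le_log_norm_add (w := w) (by rw [hre]; norm_num) (by rw [him]; norm_num)
  rw [hnorm, him] at h
  have hlog : Real.log (5 / 4 : ℝ) ≤ 1 / 4 := by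
    have := Real.log_le_sub_one_of_pos (by norm_num : (0 : ℝ) < 5 / 4); linarith
  have hπ := Real.pi_lt_d6
  rw [abs_one] at h
  norm_num at h
  linarith

/-- `log ‖3/4 + 4i‖ = ½ log(265/16) ≤ 1.404`. [folklore] -/
theorem log_norm_three_quarters_add_four_I_le :
    Real.log ‖((3 / 4 : ℝ) : ℂ) + ((4 : ℝ) : ℂ) * I‖ ≤ 1.404 := by
  set w : ℂ := ((3 / 4 : ℝ) : ℂ) + ((4 : ℝ) : ℂ) * I with hw
  have hsq : ‖w‖ ^ 2 = 16 * (265 / 256) := by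
    rw [Complex.sq_norm, Complex.normSq_apply]; simp [hw]; norm_num
  have hpos : 0 < ‖w‖ := by
    refine norm_pos_iff.2 fun h ↦ ?_
    have := congrArg Complex.im h; simp [hw] at this
  have hlog : Real.log ‖w‖ = Real.log (‖w‖ ^ 2) / 2 := by
    rw [Real.log_pow]; push_cast; ring
  rw [hlog, hsq, Real.log_mul (by norm_num) (by norm_num), show (16 : ℝ) = 2 ^ 4 by norm_num,
    Real.log_pow]
  have h2 := Real.log_two_lt_d9
  have h3 : Real.log (265 / 256 : ℝ) ≤ 265 / 256 - 1 :=
    Real.log_le_sub_one_of_pos (by norm_num)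
  push_cast
  linarith

/-- `Re ψ(3/4 + 4i) ≤ 1.64` (`log‖w‖ ≤ 1.404`, `1/(2‖w‖²) = 8/265`, `π/16 < 0.19635`). [folklore] -/
theorem re_digamma_three_quarters_add_four_I_le :
    (digamma (((3 / 4 : ℝ) : ℂ) + ((4 : ℝ) : ℂ) * I)).re ≤ 1.64 := by
  set w : ℂ := ((3 / 4 : ℝ) : ℂ) + ((4 : ℝ) : ℂ) * I with hw
  have hre : w.re = 3 / 4 := by simp [hw]
  have him : w.im = 4 := by simp [hw]
  have hsq : ‖w‖ ^ 2 = 265 / 16 := by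
    rw [Complex.sq_norm, Complex.normSq_apply, hre, him]; norm_num
  have h := re_digamma_le_log_norm_add (w := w) (by rw [hre]; norm_num) (by rw [him]; norm_num)
  rw [hsq, him] at h
  have hlog : Real.log ‖w‖ ≤ 1.404 := log_norm_three_quarters_add_four_I_le
  have hπ := Real.pi_lt_d6
  norm_num at h
  linarith

/-! ### The point `z = 3/4 + iu/2` for `|u| ≥ 8` -/

/-- For `|u| ≥ 8`: `1.3862 ≤ log ‖3/4 + iu/2‖`, and
`|Re ψ(3/4 + iu/2) − log‖3/4 + iu/2‖| ≤ 0.2266`. [folklore] -/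
theorem large_u_bounds {u : ℝ} (hu : 8 ≤ |u|) :
    1.3862 ≤ Real.log ‖((3 / 4 : ℝ) : ℂ) + ((u / 2 : ℝ) : ℂ) * I‖ ∧
    |(digamma (((3 / 4 : ℝ) : ℂ) + ((u / 2 : ℝ) : ℂ) * I)).re -
        Real.log ‖((3 / 4 : ℝ) : ℂ) + ((u / 2 : ℝ) : ℂ) * I‖| ≤ 0.2266 := by
  set z : ℂ := ((3 / 4 : ℝ) : ℂ) + ((u / 2 : ℝ) : ℂ) * I with hz
  have hre : z.re = 3 / 4 := by simp [hz]
  have him : z.im = u / 2 := by simp [hz]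
  have hsq : ‖z‖ ^ 2 = 9 / 16 + u ^ 2 / 4 := by
    rw [Complex.sq_norm, Complex.normSq_apply, hre, him]; ring
  have hu2 : 64 ≤ u ^ 2 := by nlinarith [abs_nonneg u, sq_abs u]
  have hsq16 : (16 : ℝ) ≤ ‖z‖ ^ 2 := by rw [hsq]; nlinarith
  have hsq265 : (265 / 16 : ℝ) ≤ ‖z‖ ^ 2 := by rw [hsq]; nlinarith
  have hpos : 0 < ‖z‖ := by nlinarith [norm_nonneg z]
  constructor
  · -- log ‖z‖ ≥ ½ log 16 = 2 log 2
    have h1 : Real.log 16 ≤ Real.log (‖z‖ ^ 2) := Real.log_le_log (by norm_num) hsq16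
    rw [Real.log_pow, show (16 : ℝ) = 2 ^ 4 by norm_num, Real.log_pow] at h1
    have h2 := Real.log_two_gt_d9
    push_cast at h1
    linarith
  · have h := abs_re_digamma_sub_log_norm_le (w := z) (by rw [hre]; norm_num)
      (by rw [him]; intro h0; have : u = 0 := by linarith
          rw [this, abs_zero] at hu; norm_num at hu)
    refine h.trans ?_
    rw [him]
    have h1 : 1 / (2 * ‖z‖ ^ 2) ≤ 8 / 265 := by
      rw [show (8 : ℝ) / 265 = 1 / (2 * (265 / 16)) by norm_num]
      apply one_div_le_one_div_of_le (by norm_num); linarith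
    have h2 : π / (4 * |u / 2|) ≤ π / 16 := by
      rw [abs_div, abs_two]
      apply div_le_div_of_nonneg_left Real.pi_pos.le (by norm_num)
      linarith
    have hπ := Real.pi_lt_d6
    linarith

/-! ### The identity on the line `Re s = −1/2` -/

/-- **`ζ'/ζ(−1/2 + iu)` through the functional equation**: with `s = −1/2 + iu`,
`s' = 1 − s = 3/2 − iu` and `z = s/2 + 1 = 3/4 + iu/2`,
`ζ'/ζ(s) = −ζ'/ζ(s') + log π − Re ψ(z) + 1/s`
(`ζ'/ζ(s) = −ζ'/ζ(1−s) − Γ_ℝ'/Γ_ℝ(1−s) − Γ_ℝ'/Γ_ℝ(s)`, `Γ_ℝ'/Γ_ℝ(w) = −½ log π + ½ ψ(w/2 + 1) − 1/w`,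
`ψ(z̄ + 1) = conj ψ(z) + 1/z̄`, and `1/s' = 1/(2 z̄)` cancels). [cite: Ford2002Millennium, Lemma 3.2 (proof)] -/
theorem logDeriv_zeta_left_eq (u : ℝ) :
    deriv riemannZeta (((-(1 / 2) : ℝ) : ℂ) + u * I) / riemannZeta (((-(1 / 2) : ℝ) : ℂ) + u * I) =
      -(deriv riemannZeta (((3 / 2 : ℝ) : ℂ) + (-u) * I) / riemannZeta (((3 / 2 : ℝ) : ℂ) + (-u) * I))
      + (Real.log π : ℂ)
      - ((digamma (((3 / 4 : ℝ) : ℂ) + ((u / 2 : ℝ) : ℂ) * I)).re : ℂ)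
      + 1 / (((-(1 / 2) : ℝ) : ℂ) + u * I) := by
  set s : ℂ := ((-(1 / 2) : ℝ) : ℂ) + u * I with hs
  set s' : ℂ := ((3 / 2 : ℝ) : ℂ) + (-u) * I with hs'
  set z : ℂ := ((3 / 4 : ℝ) : ℂ) + ((u / 2 : ℝ) : ℂ) * I with hz
  have hss' : s' = 1 - s := by
    rw [hs, hs']; apply Complex.ext
    · simp; norm_num
    · simp
  have hsre : s.re = -(1 / 2) := by simp [hs]
  have hs're : s'.re = 3 / 2 := by simp [hs']
  have h0 : s ≠ 0 := fun h ↦ by have := congrArg Complex.re h; rw [hsre] at this; norm_num at this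
  have h1 : s ≠ 1 := fun h ↦ by have := congrArg Complex.re h; rw [hsre] at this; norm_num at this
  have h0' : s' ≠ 0 := fun h ↦ by have := congrArg Complex.re h; rw [hs're] at this; norm_num at this
  have h1' : s' ≠ 1 := fun h ↦ by have := congrArg Complex.re h; rw [hs're] at this; norm_num at this
  have hζ : riemannZeta s ≠ 0 := PsiOneExplicit.riemannZeta_left_ne_zero u
  have hζ' : riemannZeta s' ≠ 0 := riemannZeta_ne_zero_of_one_lt_re (by rw [hs're]; norm_num)
  have e1 := PsiOneExplicit.logDeriv_riemannZeta_eq_logDeriv_riemannXi (by rw [hsre]; norm_num) h0 h1 hζ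
  have e2 := PsiOneExplicit.logDeriv_riemannZeta_eq_logDeriv_riemannXi (by rw [hs're]; norm_num) h0' h1' hζ'
  have eFE : logDeriv riemannXi s = -logDeriv riemannXi s' := by
    rw [hss', ← logDeriv_riemannXi_one_sub (1 - s), sub_sub_cancel]
  have r1 : 1 / s' = -(1 / (s - 1)) := by
    have hs1 : s - 1 ≠ 0 := sub_ne_zero.2 h1
    rw [hss']; field_simp; ring
  have r2 : 1 / (s' - 1) = -(1 / s) := by
    rw [hss', show (1 : ℂ) - s - 1 = -s by ring, one_div_neg_eq_neg_one_div]
  have key : deriv riemannZeta s / riemannZeta s =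
      -(deriv riemannZeta s' / riemannZeta s') - logDeriv Gammaℝ s' - logDeriv Gammaℝ s := by
    rw [e1, e2, eFE, r1, r2]; ring
  have hΓ := PsiOneExplicit.logDeriv_Gammaℝ_eq_shift (s := s) (by rw [hsre]; norm_num) h0
  have hΓ' := PsiOneExplicit.logDeriv_Gammaℝ_eq_shift (s := s') (by rw [hs're]; norm_num) h0'
  -- the digamma arguments
  have ez : s / 2 + 1 = z := by rw [hs, hz]; push_cast; ring
  have hconj : conj z = ((3 / 4 : ℝ) : ℂ) + ((-(u / 2) : ℝ) : ℂ) * I := by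
    simp only [hz, map_add, map_mul, Complex.conj_ofReal, Complex.conj_I]
    push_cast; ring
  have ez' : s' / 2 + 1 = conj z + 1 := by rw [hconj, hs']; push_cast; ring
  have hzbar0 : ∀ m : ℕ, conj z ≠ -m := by
    intro m h
    rw [hconj] at h
    have := congrArg Complex.re h; simp at this
    have : (0 : ℝ) ≤ m := Nat.cast_nonneg m
    linarith
  have hψ' : digamma (s' / 2 + 1) = conj (digamma z) + (conj z)⁻¹ := by
    rw [ez', Complex.digamma_apply_add_one _ hzbar0, digamma_conj]
  have hs'z : 1 / s' = 1 / (2 * conj z) := by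
    rw [hconj, hs']; congr 1; push_cast; ring
  have hzc0 : conj z ≠ 0 := by
    rw [hconj]; intro h; have := congrArg Complex.re h; simp at this
  -- real part: `ψ(z) + conj ψ(z) = 2 Re ψ(z)`
  have hre : digamma z + conj (digamma z) = ((2 * (digamma z).re : ℝ) : ℂ) := Complex.add_conj _
  have hlogπ : Complex.log π = (Real.log π : ℂ) := (Complex.ofReal_log Real.pi_pos.le).symm
  rw [key, hΓ, hΓ', ez, hψ', hs'z, hlogπ]
  have e3 : conj (digamma z) = 2 * ((digamma z).re : ℂ) - digamma z := by
    rw [← sub_eq_iff_eq_add'.2 hre.symm]; push_cast; ring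
  rw [e3]
  field_simp
  ring

/-! ### Lemma 3.2 -/

/-- Components of `V = log π − Re ψ(z) + 1/s`: with `s = −1/2 + iu`,
`Re(1/s) = −2/(1 + 4u²)`, `Im(1/s) = −4u/(1 + 4u²)`. [folklore] -/
theorem one_div_s_re_im (u : ℝ) :
    (1 / (((-(1 / 2) : ℝ) : ℂ) + u * I)).re = -2 / (1 + 4 * u ^ 2) ∧
    (1 / (((-(1 / 2) : ℝ) : ℂ) + u * I)).im = -4 * u / (1 + 4 * u ^ 2) := by
  have hn : Complex.normSq (((-(1 / 2) : ℝ) : ℂ) + u * I) = (1 + 4 * u ^ 2) / 4 := by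
    rw [Complex.normSq_apply]; simp; ring
  have hne : (1 + 4 * u ^ 2 : ℝ) ≠ 0 := by positivity
  constructor
  · rw [one_div, Complex.inv_re, hn]; simp; field_simp; norm_num
  · rw [one_div, Complex.inv_im, hn]; simp; field_simp

set_option maxHeartbeats 800000 in
/-- **Ford 2002, Lemma 3.2**: for real `u`, `|ζ'(−½ + iu)/ζ(−½ + iu)| ≤ 4.62 + ½ log(1 + u²/9)`.
Proof (sharper than Ford's near `u = 0`, where the bound is far from tight): by
`logDeriv_zeta_left_eq`, `|ζ'/ζ(s)| ≤ |ζ'/ζ(3/2 − iu)| + |Φ + iΨ|` with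
`Φ = log π − Re ψ(3/4 + iu/2) − 2/(1+4u²)`, `Ψ = −4u/(1+4u²)`, `|ζ'/ζ(3/2 − iu)| < 2`
(`norm_deriv_riemannZeta_div_lt`); `Re ψ(3/4 + iy)` is monotone in `|y|` (`re_digamma_mono`),
`≥ Re ψ(3/4) > −4/3`, `≤ 1.36` for `|y| ≤ 1`, `≤ 1.64` for `|y| ≤ 4`, and `= log‖z‖ + O(0.227)` for
`|y| ≥ 4` (`abs_re_digamma_sub_log_norm_le`); the three ranges `|u| ≤ 2`, `2 < |u| ≤ 8`, `|u| > 8`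
give `≤ 4.57`, `≤ 4.53`, `≤ 1.9 + ½ log(1 + u²/9)` respectively. [cite: Ford2002Millennium, Lemma 3.2] -/
theorem norm_logDeriv_zeta_left_le (u : ℝ) :
    ‖deriv riemannZeta (((-(1 / 2) : ℝ) : ℂ) + u * I) / riemannZeta (((-(1 / 2) : ℝ) : ℂ) + u * I)‖ ≤
      4.62 + 1 / 2 * Real.log (1 + u ^ 2 / 9) := by
  rw [logDeriv_zeta_left_eq u]
  set T : ℂ := deriv riemannZeta (((3 / 2 : ℝ) : ℂ) + (-u) * I) / riemannZeta (((3 / 2 : ℝ) : ℂ) + (-u) * I)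
    with hT
  set R : ℝ := (digamma (((3 / 4 : ℝ) : ℂ) + ((u / 2 : ℝ) : ℂ) * I)).re with hR
  set Φ : ℝ := Real.log π - R - 2 / (1 + 4 * u ^ 2) with hΦ
  set Ψ : ℝ := -4 * u / (1 + 4 * u ^ 2) with hΨ
  obtain ⟨hre1, him1⟩ := one_div_s_re_im u
  -- the vector `V = log π − R + 1/s`
  have hV : (Real.log π : ℂ) - (R : ℂ) + 1 / (((-(1 / 2) : ℝ) : ℂ) + u * I) = (Φ : ℂ) + (Ψ : ℂ) * I := by
    rw [← re_add_im (1 / (((-(1 / 2) : ℝ) : ℂ) + u * I)), hre1, him1, hΦ, hΨ]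
    push_cast; ring
  have hT2 : ‖T‖ ≤ 2 := by
    have h := norm_deriv_riemannZeta_div_lt (s := ((3 / 2 : ℝ) : ℂ) + (-u) * I) (by simp; norm_num)
    have e : (((3 / 2 : ℝ) : ℂ) + (-u) * I).re - 1 = 1 / 2 := by simp; norm_num
    rw [e] at h
    rw [hT]
    linarith
  have hlog0 : 0 ≤ Real.log (1 + u ^ 2 / 9) := Real.log_nonneg (by nlinarith)
  have hnormV : ‖(Φ : ℂ) + (Ψ : ℂ) * I‖ ^ 2 = Φ ^ 2 + Ψ ^ 2 := by
    rw [Complex.sq_norm, Complex.normSq_add_mul_I]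
  have htri : ‖-T + (Real.log π : ℂ) - (R : ℂ) + 1 / (((-(1 / 2) : ℝ) : ℂ) + u * I)‖ ≤
      2 + ‖(Φ : ℂ) + (Ψ : ℂ) * I‖ := by
    rw [show -T + (Real.log π : ℂ) - (R : ℂ) + 1 / (((-(1 / 2) : ℝ) : ℂ) + u * I) =
      -T + ((Real.log π : ℂ) - (R : ℂ) + 1 / (((-(1 / 2) : ℝ) : ℂ) + u * I)) by ring, hV]
    refine (norm_add_le _ _).trans ?_
    rw [norm_neg]; linarith
  refine htri.trans ?_
  -- common facts
  have hπ1 := log_pi_lt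
  have hπ2 := lt_log_pi
  have hden : 0 < 1 + 4 * u ^ 2 := by positivity
  have hRlow : -(4 / 3 : ℝ) ≤ R := by
    have := re_digamma_mono (x := 3 / 4) (y₁ := 0) (y₂ := u / 2) (by norm_num) (by simp [abs_nonneg])
    exact re_digamma_three_quarters_ge.trans this
  have hΨ1 : Ψ ^ 2 ≤ 1 := by
    rw [hΨ, div_pow, div_le_one (by positivity)]
    nlinarith [sq_nonneg (u ^ 2 - 1 / 4)]
  rcases le_or_gt |u| 2 with hu2 | hu2
  · -- Case `|u| ≤ 2`
    have hRup : R ≤ 1.36 := by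
      have := re_digamma_mono (x := 3 / 4) (y₁ := u / 2) (y₂ := 1) (by norm_num)
        (by rw [abs_div, abs_two, abs_one]; linarith)
      exact this.trans re_digamma_three_quarters_add_I_le
    have hu4 : u ^ 2 ≤ 4 := by nlinarith [abs_nonneg u, sq_abs u]
    have hfrac1 : 2 / 17 ≤ 2 / (1 + 4 * u ^ 2) := div_le_div_of_nonneg_left (by norm_num) hden (by linarith)
    have hfrac2 : 2 / (1 + 4 * u ^ 2) ≤ 2 := by
      rw [div_le_iff₀ hden]; nlinarith
    have hΦup : Φ ≤ 2.361 := by rw [hΦ]; linarith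
    have hΦlo : -2.27 ≤ Φ := by rw [hΦ]; linarith
    have hV2 : ‖(Φ : ℂ) + (Ψ : ℂ) * I‖ ≤ 2.565 := by
      have h1 : ‖(Φ : ℂ) + (Ψ : ℂ) * I‖ ^ 2 ≤ 2.565 ^ 2 := by
        rw [hnormV]; nlinarith
      exact (pow_le_pow_iff_left₀ (norm_nonneg _) (by norm_num) two_ne_zero).1 h1
    linarith
  rcases le_or_gt |u| 8 with hu8 | hu8
  · -- Case `2 < |u| ≤ 8`
    have hRup : R ≤ 1.64 := by
      have := re_digamma_mono (x := 3 / 4) (y₁ := u / 2) (y₂ := 4) (by norm_num)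
        (by rw [abs_div, abs_two, show |(4 : ℝ)| = 4 by norm_num]; linarith)
      exact this.trans re_digamma_three_quarters_add_four_I_le
    have hu4 : 4 < u ^ 2 := by nlinarith [abs_nonneg u, sq_abs u]
    have hfrac1 : 0 ≤ 2 / (1 + 4 * u ^ 2) := by positivity
    have hfrac2 : 2 / (1 + 4 * u ^ 2) ≤ 2 / 17 := div_le_div_of_nonneg_left (by norm_num) (by norm_num) (by linarith)
    have hΦup : Φ ≤ 2.4784 := by rw [hΦ]; linarith
    have hΦlo : -0.668 ≤ Φ := by rw [hΦ]; linarith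
    have hΨ2 : Ψ ^ 2 ≤ (8 / 17) ^ 2 := by
      rw [hΨ, div_pow, div_le_iff₀ (by positivity)]
      -- 16 u² · 289 ≤ 64 (1 + 4u²)²  ⟸  (u² − 4)(16u² − 1/4) ≥ 0
      nlinarith [hu4]
    have hV2 : ‖(Φ : ℂ) + (Ψ : ℂ) * I‖ ≤ 2.523 := by
      have h1 : ‖(Φ : ℂ) + (Ψ : ℂ) * I‖ ^ 2 ≤ 2.523 ^ 2 := by
        rw [hnormV]; nlinarith
      exact (pow_le_pow_iff_left₀ (norm_nonneg _) (by norm_num) two_ne_zero).1 h1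
    linarith
  · -- Case `|u| > 8`
    obtain ⟨hL, hψL⟩ := large_u_bounds hu8.le
    set L : ℝ := Real.log ‖((3 / 4 : ℝ) : ℂ) + ((u / 2 : ℝ) : ℂ) * I‖ with hLdef
    rw [abs_le] at hψL
    have hu64 : 64 < u ^ 2 := by nlinarith [abs_nonneg u, sq_abs u]
    have hfrac1 : 0 ≤ 2 / (1 + 4 * u ^ 2) := by positivity
    have hfrac2 : 2 / (1 + 4 * u ^ 2) ≤ 2 / 257 := div_le_div_of_nonneg_left (by norm_num) (by norm_num) (by linarith)
    have hΦneg : Φ ≤ 0 := by rw [hΦ]; linarith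
    have hΦabs : |Φ| ≤ L - 0.8556 := by
      rw [abs_of_nonpos hΦneg, hΦ]; linarith
    have hΨabs : |Ψ| ≤ 1 / 8 := by
      rw [hΨ, abs_div, abs_of_pos hden, div_le_iff₀ hden, abs_mul, show |(-4 : ℝ)| = 4 by norm_num]
      nlinarith [abs_nonneg u, sq_abs u]
    have hV2 : ‖(Φ : ℂ) + (Ψ : ℂ) * I‖ ≤ |Φ| + |Ψ| := by
      refine (norm_add_le _ _).trans ?_
      rw [norm_mul, Complex.norm_I, mul_one, Complex.norm_real, Complex.norm_real, Real.norm_eq_abs,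
        Real.norm_eq_abs]
    -- `L ≤ ½ log(9/4) + ½ log(1 + u²/9) ≤ 5/8 + ½ log(1 + u²/9)`
    have hLup : L ≤ 5 / 8 + 1 / 2 * Real.log (1 + u ^ 2 / 9) := by
      have hsq : ‖((3 / 4 : ℝ) : ℂ) + ((u / 2 : ℝ) : ℂ) * I‖ ^ 2 = 9 / 16 + u ^ 2 / 4 := by
        rw [Complex.sq_norm, Complex.normSq_add_mul_I]; ring
      have hpos : 0 < ‖((3 / 4 : ℝ) : ℂ) + ((u / 2 : ℝ) : ℂ) * I‖ := by
        have : 0 < ‖((3 / 4 : ℝ) : ℂ) + ((u / 2 : ℝ) : ℂ) * I‖ ^ 2 := by rw [hsq]; positivity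
        nlinarith [norm_nonneg (((3 / 4 : ℝ) : ℂ) + ((u / 2 : ℝ) : ℂ) * I)]
      have hL2 : L = Real.log (9 / 16 + u ^ 2 / 4) / 2 := by
        rw [hLdef, ← hsq, Real.log_pow]; push_cast; ring
      have hle : Real.log (9 / 16 + u ^ 2 / 4) ≤ Real.log (9 / 4) + Real.log (1 + u ^ 2 / 9) := by
        rw [← Real.log_mul (by norm_num) (by positivity)]
        exact Real.log_le_log (by positivity) (by nlinarith)
      have h94 : Real.log (9 / 4 : ℝ) ≤ 5 / 4 := by
        have := Real.log_le_sub_one_of_pos (by norm_num : (0 : ℝ) < 9 / 4); linarith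
      rw [hL2]; linarith
    linarith

end FordL32

end Literature.NumberTheory.LFunctions
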